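import Summits.AtomisticToContinuum.Crystallization.Theorems.FreeSplittingCertificatesStrictSplittingRuleP1ReadRoute
import Summits.AtomisticToContinuum.Crystallization.Theorems.FreeSplittingCertificatesStrictSplittingRuleP1ReadSharp

/-!
# `StrictSplittingRule` (stmt-AtomisticToContinuum-12560): ASSEMBLY GLUE II — decay of finitely supported / summed tables, and the routed readout in DYAD form (P1 interpolant object, part 51)

Route `FreeSplittingCertificates`, crux r3 `StrictSplittingRule` (H12⋆ = `stub_coreJointCoercive`), unit b2b-freesplit-B gen 32.
VALUE = glue items G10 and the dyad form of G6 of the kernel assembly map (HOME FAR-LEMMA-SPEC §23 (b), terms (T5), (T9)):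
* **`table_decay_of_finite`** — a second-order table `T b e s s'` supported on finitely many index differences `e` and bounded by `B` satisfies the decay clause of
  `CoreJointCoercive`: `|T(b_p)(q−p) s s'| ≤ C·(1+‖y_q − y_p‖)⁻⁶` with `C = B(1+L)⁶`, `L = Σ_{e∈S}(‖y_e‖ + ‖y_{−e}‖)` (Bravais covariance `h1_sub_eq`) — the NEAR tables;
  `table_decay_of_finite₃` — the same for first-order tables `β b e s`; **`table_decay_add`** (`₃`) — sums of decaying tables decay (near + far);
* **`tsum_readout_route_le_table_dyad_p1DispSite`** — bond weights → routed legs → cells with the DYAD capacity `Σᶠ_e θ_{eT}·w'(e)·|d_eᵀ(G_T(U) − A)|²` (parts 48 + 49), the form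
  the certified per-cell budget (B) bounds by `λ_max`.
NOT a proof of H12⋆, NOT summit progress.  [folklore]
-/

noncomputable section

open Set Function
open scoped BigOperators

namespace Summit.AtomisticToContinuum.Crystallization.Theorems.StrictSplittingRuleBirth

open Literature.MathematicalPhysics.StatisticalMechanics
open Summit.AtomisticToContinuum.Crystallization.Theorems.PalmUnimodularRigidity.LayeredLawsSelectHcp

/-! ## G10: decay of finitely supported tables and of sums of tables -/

/-- The relative site vector of an index difference in a finite set is bounded: `‖y_q − y_p‖ ≤ Σ_{e∈S}(‖y_e‖ + ‖y_{−e}‖)` when `q − p ∈ S`. -/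
theorem norm_hcpSite_sub_le_of_mem {a h : ℝ} (S : Finset (ℤ × ℤ × ℤ)) {p q : ℤ × ℤ × ℤ} (hmem : q - p ∈ S) :
    ‖hcpSite a h q - hcpSite a h p‖ ≤ ∑ e ∈ S, (‖hcpSite a h e‖ + ‖hcpSite a h (-e)‖) := by
  have e1 : hcpSite a h q - hcpSite a h p = if Even p.1 then hcpSite a h (q - p) else -hcpSite a h (-(q - p)) := by
    have h1 := h1_sub_eq a h p (q - p)
    rwa [show p + (q - p) = q by abel] at h1
  have hle : ‖hcpSite a h (q - p)‖ + ‖hcpSite a h (-(q - p))‖ ≤ ∑ e ∈ S, (‖hcpSite a h e‖ + ‖hcpSite a h (-e)‖) :=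
    Finset.single_le_sum (f := fun e => ‖hcpSite a h e‖ + ‖hcpSite a h (-e)‖) (fun e _ => by positivity) hmem
  rw [e1]
  split_ifs
  · linarith [norm_nonneg (hcpSite a h (-(q - p)))]
  · rw [norm_neg]; linarith [norm_nonneg (hcpSite a h (q - p))]

/-- **Finitely supported second-order tables decay** (in the convention of `CoreJointCoercive`).  NOT a proof of H12⋆, NOT summit progress. -/
theorem table_decay_of_finite {a h : ℝ} (T : Bool → (ℤ × ℤ × ℤ) → (ℤ × ℤ × ℤ) → (ℤ × ℤ × ℤ) → ℝ) (S : Finset (ℤ × ℤ × ℤ)) {B : ℝ}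
    (hT : ∀ b e s s', e ∉ S → T b e s s' = 0) (hB : ∀ b e s s', |T b e s s'| ≤ B) :
    ∃ C : ℝ, ∀ p q : ℤ × ℤ × ℤ, ∀ s s', |T (decide (Even p.1)) (q - p) s s'| ≤ C * ((1 + ‖hcpSite a h q - hcpSite a h p‖)⁻¹) ^ 6 := by
  set L : ℝ := ∑ e ∈ S, (‖hcpSite a h e‖ + ‖hcpSite a h (-e)‖) with hL
  have hL0 : 0 ≤ L := Finset.sum_nonneg fun e _ => by positivity
  have hB0 : 0 ≤ B := (abs_nonneg _).trans (hB true 0 0 0)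
  refine ⟨B * (1 + L) ^ 6, fun p q s s' => ?_⟩
  by_cases hmem : q - p ∈ S
  · have hd : ‖hcpSite a h q - hcpSite a h p‖ ≤ L := norm_hcpSite_sub_le_of_mem S hmem
    have hx : 0 < 1 + ‖hcpSite a h q - hcpSite a h p‖ := by positivity
    have h1 : (1 + L)⁻¹ ≤ (1 + ‖hcpSite a h q - hcpSite a h p‖)⁻¹ := inv_anti₀ hx (by linarith)
    have h2 : ((1 + L)⁻¹) ^ 6 ≤ ((1 + ‖hcpSite a h q - hcpSite a h p‖)⁻¹) ^ 6 := pow_le_pow_left₀ (by positivity) h1 6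
    have hL1 : (1 + L) ^ 6 * ((1 + L)⁻¹) ^ 6 = 1 := by
      rw [← mul_pow, mul_inv_cancel₀ (by positivity : (1 + L) ≠ 0), one_pow]
    calc |T (decide (Even p.1)) (q - p) s s'| ≤ B := hB _ _ _ _
      _ = B * (1 + L) ^ 6 * ((1 + L)⁻¹) ^ 6 := by rw [mul_assoc, hL1, mul_one]
      _ ≤ B * (1 + L) ^ 6 * ((1 + ‖hcpSite a h q - hcpSite a h p‖)⁻¹) ^ 6 := mul_le_mul_of_nonneg_left h2 (by positivity)
  · rw [hT _ _ _ _ hmem, abs_zero]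
    positivity

/-- **Finitely supported first-order tables decay** (the `β`-clause convention of `CoreJointCoercive`).  NOT a proof of H12⋆, NOT summit progress. -/
theorem table_decay_of_finite₃ {a h : ℝ} (T : Bool → (ℤ × ℤ × ℤ) → (ℤ × ℤ × ℤ) → ℝ) (S : Finset (ℤ × ℤ × ℤ)) {B : ℝ}
    (hT : ∀ b e s, e ∉ S → T b e s = 0) (hB : ∀ b e s, |T b e s| ≤ B) :
    ∃ C : ℝ, ∀ p q : ℤ × ℤ × ℤ, ∀ s, |T (decide (Even p.1)) (q - p) s| ≤ C * ((1 + ‖hcpSite a h q - hcpSite a h p‖)⁻¹) ^ 6 := by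
  obtain ⟨C, hC⟩ := table_decay_of_finite (a := a) (h := h) (fun b e s _ => T b e s) S (fun b e s _ he => hT b e s he) (fun b e s _ => hB b e s)
  exact ⟨C, fun p q s => hC p q s s⟩

/-- **Sums of decaying second-order tables decay.** -/
theorem table_decay_add {a h C₁ C₂ : ℝ} (T₁ T₂ : Bool → (ℤ × ℤ × ℤ) → (ℤ × ℤ × ℤ) → (ℤ × ℤ × ℤ) → ℝ)
    (h₁ : ∀ p q : ℤ × ℤ × ℤ, ∀ s s', |T₁ (decide (Even p.1)) (q - p) s s'| ≤ C₁ * ((1 + ‖hcpSite a h q - hcpSite a h p‖)⁻¹) ^ 6)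
    (h₂ : ∀ p q : ℤ × ℤ × ℤ, ∀ s s', |T₂ (decide (Even p.1)) (q - p) s s'| ≤ C₂ * ((1 + ‖hcpSite a h q - hcpSite a h p‖)⁻¹) ^ 6) :
    ∀ p q : ℤ × ℤ × ℤ, ∀ s s', |T₁ (decide (Even p.1)) (q - p) s s' + T₂ (decide (Even p.1)) (q - p) s s'| ≤
      (C₁ + C₂) * ((1 + ‖hcpSite a h q - hcpSite a h p‖)⁻¹) ^ 6 := fun p q s s' =>
  (abs_add_le _ _).trans (by rw [add_mul]; exact add_le_add (h₁ p q s s') (h₂ p q s s'))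

/-- **Sums of decaying first-order tables decay.** -/
theorem table_decay_add₃ {a h C₁ C₂ : ℝ} (T₁ T₂ : Bool → (ℤ × ℤ × ℤ) → (ℤ × ℤ × ℤ) → ℝ)
    (h₁ : ∀ p q : ℤ × ℤ × ℤ, ∀ s, |T₁ (decide (Even p.1)) (q - p) s| ≤ C₁ * ((1 + ‖hcpSite a h q - hcpSite a h p‖)⁻¹) ^ 6)
    (h₂ : ∀ p q : ℤ × ℤ × ℤ, ∀ s, |T₂ (decide (Even p.1)) (q - p) s| ≤ C₂ * ((1 + ‖hcpSite a h q - hcpSite a h p‖)⁻¹) ^ 6) :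
    ∀ p q : ℤ × ℤ × ℤ, ∀ s, |T₁ (decide (Even p.1)) (q - p) s + T₂ (decide (Even p.1)) (q - p) s| ≤
      (C₁ + C₂) * ((1 + ‖hcpSite a h q - hcpSite a h p‖)⁻¹) ^ 6 := fun p q s =>
  (abs_add_le _ _).trans (by rw [add_mul]; exact add_le_add (h₁ p q s) (h₂ p q s))

/-! ## G6 in dyad form: bond weights → routed legs → cells -/

/-- **THE ROUTED READOUT OVER AN ALLOCATION TABLE, DYAD FORM, far-ledger field**: for `V = p1DispSite a h U b₀ A`, a bond offset `s`, intermediate offsets from a finite set,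
nonnegative summable bond weights `wv`, ANY share table with the carrier property, and the routed leg weight `w'` of part 48,
`Σ'_q wv q·|V(q+s) − V q|² ≤ Σ'_T Σᶠ_e θ_{eT}·w'(e)·|d_eᵀ(G_T(U) − A)|²` (dyad family summable).  NOT a proof of H12⋆, NOT summit progress. -/
theorem tsum_readout_route_le_table_dyad_p1DispSite {a h : ℝ} (ha : 0 < a) (hh : 0 < h) (U : ℤ × ℤ × ℤ → (Fin 3 → ℝ))
    (hU : (support U).Finite) (b₀ : Fin 3 → ℝ) (A : Fin 3 → Fin 3 → ℝ) (s : ℤ × ℤ × ℤ)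
    (o : (ℤ × ℤ × ℤ) → Fin 3 → ℤ × ℤ × ℤ) (S : Finset (ℤ × ℤ × ℤ)) (ho : ∀ q i, o q i ∈ S)
    (wv : ℤ × ℤ × ℤ → ℝ) (hwv : ∀ q, 0 ≤ wv q) (hwvs : Summable wv)
    (θ : (ℤ × ℤ × ℤ) × (ℤ × ℤ × ℤ) → (ℤ × ℤ × ℤ) × Fin 6 → ℝ) (hθ : ∀ e T, 0 ≤ θ e T)
    (hfinE : ∀ e, (Function.support (θ e)).Finite) (hfinC : ∀ T, (Function.support fun e => θ e T).Finite)
    (hsum : ∀ e, ∑ᶠ T, θ e T = 1)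
    (hcar : ∀ e T, θ e T ≠ 0 → ∃ m m' : Fin 4, e.1 = T.1 + p1VertOff (p1Par T.1) T.2 m ∧
      e.1 + e.2 = T.1 + p1VertOff (p1Par T.1) T.2 m') :
    Summable (fun T : (ℤ × ℤ × ℤ) × Fin 6 => ∑ᶠ e : (ℤ × ℤ × ℤ) × (ℤ × ℤ × ℤ), θ e T *
      (∑ i : Fin 3, (2 / 3) * ((if e.2 = o e.1 i then wv e.1 else 0) +
        (if o (e.1 - (s - e.2)) i = s - e.2 then wv (e.1 - (s - e.2)) else 0))) *
      fpSq (fun k => (hcpSite a h (e.1 + e.2) 0 - hcpSite a h e.1 0) * (p1CellGrad a h U T 0 k - A 0 k) +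
        (hcpSite a h (e.1 + e.2) 1 - hcpSite a h e.1 1) * (p1CellGrad a h U T 1 k - A 1 k) +
        (hcpSite a h (e.1 + e.2) 2 - hcpSite a h e.1 2) * (p1CellGrad a h U T 2 k - A 2 k))) ∧
    ∑' q : ℤ × ℤ × ℤ, wv q * fpSq (fun k => p1DispSite a h U b₀ A (q + s) k - p1DispSite a h U b₀ A q k) ≤
    ∑' T : (ℤ × ℤ × ℤ) × Fin 6, ∑ᶠ e : (ℤ × ℤ × ℤ) × (ℤ × ℤ × ℤ), θ e T *
      (∑ i : Fin 3, (2 / 3) * ((if e.2 = o e.1 i then wv e.1 else 0) +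
        (if o (e.1 - (s - e.2)) i = s - e.2 then wv (e.1 - (s - e.2)) else 0))) *
      fpSq (fun k => (hcpSite a h (e.1 + e.2) 0 - hcpSite a h e.1 0) * (p1CellGrad a h U T 0 k - A 0 k) +
        (hcpSite a h (e.1 + e.2) 1 - hcpSite a h e.1 1) * (p1CellGrad a h U T 1 k - A 1 k) +
        (hcpSite a h (e.1 + e.2) 2 - hcpSite a h e.1 2) * (p1CellGrad a h U T 2 k - A 2 k)) := by
  obtain ⟨_, _, hle1⟩ := tsum_readout_route_le_legs_p1DispSite ha hh U hU b₀ A s o S ho wv hwv hwvs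
  obtain ⟨_, heq⟩ := tsum_routeWeight_readout_eq ha hh U hU b₀ A s o S ho wv hwv hwvs
  obtain ⟨hsD, _, hle2⟩ := tsum_readout_leg_table_le_dyad_p1DispSite ha hh U hU b₀ A _ (routeWeight_nonneg s o wv hwv) θ hθ hfinE hfinC
    hsum hcar (summable_routeWeight_load a h s o S ho wv hwv hwvs)
  refine ⟨hsD, hle1.trans ?_⟩
  rw [← heq]
  exact hle2

end Summit.AtomisticToContinuum.Crystallization.Theorems.StrictSplittingRuleBirth

end
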